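import Summits.ABC.IUTFork.Cor312StatementBridge
import Summits.ABC.IUTFork.Cor312StatementBridges
import HarnessLib

/-!
# The fork at [IUTchIII] Corollary 3.12 — NON-VACUITY of the verbatim-statement bridge (`BridgeHyps`)

Record-only file (D-0012) of the abc-iut cell (Cor. 3.12 sub-crew, wave 2, seat abc-iut-c312-6, board row W2-C; the cell's
vacuity-audit duty, LANA Rem. 8.2.1); TAKES NO SIDE. `Cor312StatementBridge` maps c312-7's verbatim `Cor312.Setting P` to a
skeleton `Cor312Setting` under the hypothesis structure `Cor312Vol.BridgeHyps P` (monotone log-volume, admissible possible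
images, nonempty hull-sets and Θ-images, `ThetaFinite`). This file shows the hypotheses are SATISFIABLE: over c312-7's
reusable toy parts (`Cor312.Checks.toyIndex` / `toyShells` / `toyData 0` / `toySituation 0` / `toySig`) it builds the
NONEMPTY toy setting `toySettingNE` — hull frame `{univ}` (every region bounded and with hull), Θ-pilot and `q`-pilot
regions `univ`, all log-volumes `0` — proves `bridgeHyps_toySettingNE : BridgeHyps toySettingNE`, and runs the bridge end
to end: the printed `Statement` holds for it VIA the skeleton (`statement_of_qRegion_mem_possibleImages`, Reading 3:
the `q`-pilot region IS a possible image here). c312-7's own toy (`Checks.toySetting c`, empty Θ-regions, `Statement ↔ 0 ≤ c`)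
is the complementary witness that `Statement` is contentful; one writer per toy. [folklore]
Deliberately NOT here: anything about the real objects.
-/

noncomputable section

namespace Summit.ABC

namespace IUTFork

namespace Cor312Vol

namespace Checks

open Thm311 Cor312 Cor312.Checks

/-- The FULL hull frame: the only hull-set is everything; every region is bounded and admits a hull. [folklore] -/
def fullFrame (X : Type) : HullFrame X where
  Hul := {Set.univ}
  IsBounded := fun _ => True
  HasHull := fun _ => True
  hul_bounded := fun _ _ => trivial
  bounded_mono := fun _ _ _ _ => trivial
  exists_hul := fun _ _ => ⟨Set.univ, rfl, Set.subset_univ _⟩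
  hull_mem := fun U _ _ => by
    have h1 : {H | H ∈ ({Set.univ} : Set (Set X)) ∧ U ⊆ H} = {Set.univ} := by
      ext H
      simp only [Set.mem_setOf_eq, Set.mem_singleton_iff]
      exact ⟨fun h => h.1, fun h => ⟨h, h ▸ Set.subset_univ _⟩⟩
    rw [h1, Set.sInter_singleton]
    rfl

/-- The hull of the full frame is everything. [folklore] -/
theorem fullFrame_hull (X : Type) (U : Set X) : (fullFrame X).hull U = Set.univ := by
  apply Set.eq_univ_of_univ_subset
  have hmem : (fullFrame X).hull U ∈ (fullFrame X).Hul := (fullFrame X).hull_mem_of_hasHull trivial trivial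
  exact (Set.mem_singleton_iff.mp hmem).symm.subset

/-- The NONEMPTY toy setting over c312-7's `toySituation 0` (all log-volumes `0`): c312-7's one-point lattice/pilot
data, the full hull frame, Θ-pilot region `univ` at every `m`, `q`-pilot region `univ`. [folklore] -/
def toySettingNE : Setting (toySituation 0) where
  n := 0
  HT := ℤ × ℤ
  LogLink := fun _ _ => Unit
  IsFull := fun _ => True
  lattice :=
    { theater := fun n m => (n, m)
      distinct := fun p q h => by simpa using h
      logLink := fun _ _ => ()
      logLink_full := fun _ _ => trivial }
  Frd := Unit
  IsoF := fun _ _ => Unit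
  Ob := fun _ => Unit
  realify := id
  Strip := Unit
  IsoS := fun _ _ => Unit
  M := fun _ _ => Unit
  sig := toySig
  split := { Msplit := fun _ _ => ⊤, exists_gen := fun _ _ => ⟨⟨(), trivial⟩, top_unit_isGenerator _⟩ }
  ObΔ := Unit
  N := fun _ _ => Unit
  qData := { q := fun _ _ => (), q_gen := fun _ _ => unit_isGenerator _, objOf := fun _ => () }
  frame := fun _ _ => fullFrame _
  hul_adm := fun _ _ _ _ => trivial
  thetaRegionOf := fun _ _ _ _ => Set.univ
  qRegionOf := fun _ _ _ => Set.univ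
  qRegion_mem := fun _ _ => rfl
  qSupport_finite := fun _ => Set.toFinite _

/-- The (Ind3)-enlarged Θ-region of the nonempty toy is everything. [folklore] -/
theorem toySettingNE_thetaRegion3 (j : toyIndex.Label) (vQ : toyIndex.VQ) :
    toySettingNE.thetaRegion3 j vQ = Set.univ := by
  apply Set.eq_univ_of_univ_subset
  exact Set.subset_iUnion (fun m : ℤ => toySettingNE.thetaRegion m j vQ) 0

/-- Every possible image of the nonempty toy is everything (translates of `univ` by linear automorphisms). [folklore] -/
theorem toySettingNE_possibleImages {j : toyIndex.Label} {vQ : toyIndex.VQ} {U : Set ((toySituation 0).L.Packet j vQ)}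
    (hU : U ∈ toySettingNE.possibleImages j vQ) : U = Set.univ := by
  obtain ⟨Φ, -, rfl⟩ := hU
  rw [toySettingNE_thetaRegion3, Set.image_univ]
  exact Set.range_eq_univ.mpr (Φ j vQ).surjective

/-- The `q`-pilot region of the nonempty toy IS a possible image (Reading 3 holds in the toy). [folklore] -/
theorem toySettingNE_qRegion_mem (j : toyIndex.Label) (vQ : toyIndex.VQ) :
    toySettingNE.qRegion j vQ ∈ toySettingNE.possibleImages j vQ := by
  have h := toySettingNE.thetaRegion3_mem_possibleImages j vQ
  rw [toySettingNE_thetaRegion3] at h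
  exact h

/-- Every union of possible images admits its hull in the full frame. [folklore] -/
theorem toySettingNE_hullDefined (j : toyIndex.Label) (vQ : toyIndex.VQ) : toySettingNE.HullDefined j vQ :=
  ⟨trivial, trivial⟩

/-- The local Θ-volume of the nonempty toy is `0`. [folklore] -/
theorem toySettingNE_thetaLocal (j : toyIndex.Label) (vQ : toyIndex.VQ) :
    toySettingNE.thetaLocal j vQ = ((0 : ℝ) : WithTop ℝ) := by
  unfold Setting.thetaLocal
  rw [if_pos (toySettingNE_hullDefined j vQ)]
  have hh : toySettingNE.thetaHull j vQ = Set.univ := fullFrame_hull _ _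
  rw [hh]
  exact congrArg _ (toyData_logvol_univ 0 j vQ)

/-- The nonempty toy is `ThetaFinite`. [folklore] -/
theorem toySettingNE_thetaFinite : toySettingNE.ThetaFinite :=
  ⟨fun j vQ => by rw [toySettingNE_thetaLocal (Setting.labelSucc j) vQ]; exact WithTop.coe_ne_top,
    fun _ => Set.toFinite _⟩

/-- **NON-VACUITY OF THE BRIDGE HYPOTHESES**: `BridgeHyps` holds for the nonempty toy (monotonicity: all log-volumes of
`toyData 0` are `0`; admissibility: everything is admissible; finiteness: the index types are finite; nonemptiness:
hull-sets and Θ-regions are `univ`). [folklore] -/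
theorem bridgeHyps_toySettingNE : BridgeHyps toySettingNE where
  mono := fun i vQ A B _ _ _ => by
    show (toyData 0).logvol (Setting.labelSucc i) vQ A ≤ (toyData 0).logvol (Setting.labelSucc i) vQ B
    unfold toyData
    simp only
    split_ifs <;> exact le_rfl
  image_adm := fun _ _ _ _ => trivial
  image_fin := fun _ => Set.toFinite _
  hul_nonempty := fun _ _ H hH => by
    rw [show H = Set.univ from Set.mem_singleton_iff.mp hH]
    exact Set.univ_nonempty
  theta_nonempty := fun i vQ => by
    rw [toySettingNE_thetaRegion3 (Setting.labelSucc i) vQ]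
    exact Set.univ_nonempty
  finite := toySettingNE_thetaFinite

/-- **The bridge runs end to end**: the printed Statement holds for the nonempty toy, obtained THROUGH the skeleton
(`statement_of_qRegion_mem_possibleImages`: Reading 3 ⟹ `QIsImage` ⟹ `Cor312` ⟹ `Statement`). [folklore] -/
theorem toySettingNE_statement : toySettingNE.Statement :=
  statement_of_qRegion_mem_possibleImages bridgeHyps_toySettingNE fun i vQ =>
    toySettingNE_qRegion_mem (Setting.labelSucc i) vQ

/-- … and therefore the skeleton's `Cor312` holds for the constructed `Cor312Setting` of the toy. [folklore] -/
theorem toySettingNE_cor312 : (toCor312Setting bridgeHyps_toySettingNE).Cor312 :=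
  (statement_iff_cor312 bridgeHyps_toySettingNE).mp toySettingNE_statement

end Checks

end Cor312Vol

end IUTFork

end Summit.ABC

end
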